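import Mathlib

/-!
# Route BarrierLever — item `PartitionMinorsHitByVP` (stmt-ValiantsHypothesis-19717), line `hidden-states`:
# PEELING ONE COORDINATE off a source-map sum

Helper file (`--supports stmt-ValiantsHypothesis-19717`; cell valiant-natproofs, 𝒟-side door (c), registered line
`Cruxes/PartitionMinorsHitByVP/Lines/hidden_states.lean` v8; prover seat val-np-p6 gen 16).  Closes NO item; definition-free;
companion of `…HiddenStatesPathTableTransfer` (the dual-vector engine, memo HOME/val-np-p6/g16/MEMO-valnp6-g16.md §2–3).

`sum_maps_insert` — the source maps of `S' + a` are the source maps of `S'` together with a free choice `q` of the image of `a`: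
`Σ_{φ ∈ maps(S'+a)} wt(φ)·ζ(image φ) = Σ_{φ' ∈ maps S'} wt(φ')·Σ_q w a q·ζ(image φ' + q)`.  This is the step
`λ(F·y_a) = Σ_{R'} c_F(R') Σ_q w a q ζ(R'+q)` of the memo (used with `a` the top Y-coordinate of a row, where the inner sum is the
local identity (L<) of `…HiddenStatesPathTableStaircase`).

WHAT THIS IS NOT: no item statement; nothing on crux 14610 or VP ≠ VNP.
-/

set_option linter.dupNamespace false

namespace Summit.ValiantsHypothesis.ValiantsHypothesis.Theorems.BarrierLever.HiddenStates

open Finset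

noncomputable section

namespace PathTable

variable {ι : Type} [Fintype ι] [DecidableEq ι]

/-- updating a source map of `S'` at `a ∉ S'` gives a source map of `S' + a`. -/
theorem update_mem_maps {S' : Finset ι} {a : ι} {φ' : ι → ι}
    (hφ' : φ' ∈ Fintype.piFinset (fun b => if b ∈ S' then (Finset.univ : Finset ι) else {b})) (q : ι) :
    Function.update φ' a q ∈ Fintype.piFinset (fun b => if b ∈ insert a S' then (Finset.univ : Finset ι) else {b}) := by
  rw [Fintype.mem_piFinset] at hφ' ⊢
  intro b
  by_cases hb : b = a
  · subst hb; simp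
  · rw [Function.update_of_ne hb]
    by_cases hbS : b ∈ S'
    · simp [hbS]
    · have := hφ' b
      rw [if_neg hbS] at this
      rw [if_neg (by simp [hb, hbS])]
      exact this

/-- restricting a source map of `S' + a` (resetting `a ↦ a`) gives a source map of `S'`. -/
theorem reset_mem_maps {S' : Finset ι} {a : ι} (ha : a ∉ S') {φ : ι → ι}
    (hφ : φ ∈ Fintype.piFinset (fun b => if b ∈ insert a S' then (Finset.univ : Finset ι) else {b})) :
    Function.update φ a a ∈ Fintype.piFinset (fun b => if b ∈ S' then (Finset.univ : Finset ι) else {b}) := by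
  rw [Fintype.mem_piFinset] at hφ ⊢
  intro b
  by_cases hb : b = a
  · subst hb; simp [ha]
  · rw [Function.update_of_ne hb]
    by_cases hbS : b ∈ S'
    · simp [hbS]
    · have := hφ b
      rw [if_neg (by simp [hb, hbS])] at this
      rw [if_neg hbS]
      exact this

/-- ★ **Peeling one coordinate.**  For `a ∉ S'`, a weight `w` and any function `ζ` on sets:
`Σ_{φ ∈ maps(S'+a)} (∏_{b ∈ S'+a} w b (φ b))·ζ((S'+a).image φ) = Σ_{φ' ∈ maps S'} (∏_{b∈S'} w b (φ' b))·Σ_q w a q·ζ((S'.image φ') + q)`. -/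
theorem sum_maps_insert (w : ι → ι → ℂ) (ζ : Finset ι → ℂ) {S' : Finset ι} {a : ι} (ha : a ∉ S') :
    ∑ φ ∈ Fintype.piFinset (fun b => if b ∈ insert a S' then (Finset.univ : Finset ι) else {b}),
        (∏ b ∈ insert a S', w b (φ b)) * ζ ((insert a S').image φ) =
      ∑ φ' ∈ Fintype.piFinset (fun b => if b ∈ S' then (Finset.univ : Finset ι) else {b}),
        (∏ b ∈ S', w b (φ' b)) * ∑ q : ι, w a q * ζ (insert q (S'.image φ')) := by
  classical
  -- rewrite the right-hand side as a sum over pairs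
  have hR : ∑ φ' ∈ Fintype.piFinset (fun b => if b ∈ S' then (Finset.univ : Finset ι) else {b}),
        (∏ b ∈ S', w b (φ' b)) * ∑ q : ι, w a q * ζ (insert q (S'.image φ')) =
      ∑ p ∈ (Fintype.piFinset (fun b => if b ∈ S' then (Finset.univ : Finset ι) else {b})) ×ˢ (Finset.univ : Finset ι),
        (∏ b ∈ S', w b (p.1 b)) * (w a p.2 * ζ (insert p.2 (S'.image p.1))) := by
    rw [Finset.sum_product]
    exact Finset.sum_congr rfl fun φ' _ => by rw [Finset.mul_sum]
  rw [hR]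
  refine Finset.sum_bij' (fun φ _ => (Function.update φ a a, φ a)) (fun p _ => Function.update p.1 a p.2) ?_ ?_ ?_ ?_ ?_
  · intro φ hφ
    exact Finset.mem_product.2 ⟨reset_mem_maps ha hφ, Finset.mem_univ _⟩
  · intro p hp
    exact update_mem_maps (Finset.mem_product.1 hp).1 p.2
  · intro φ hφ
    funext b
    by_cases hb : b = a
    · subst hb; simp
    · simp [Function.update_of_ne hb]
  · intro p hp
    obtain ⟨hp1, -⟩ := Finset.mem_product.1 hp
    have hpa : p.1 a = a := by
      have := Fintype.mem_piFinset.1 hp1 a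
      rw [if_neg ha, Finset.mem_singleton] at this
      exact this
    refine Prod.ext ?_ ?_
    · funext b
      by_cases hb : b = a
      · subst hb; simp [hpa]
      · simp [Function.update_of_ne hb]
    · simp
  · intro φ hφ
    -- the summands agree
    have hprod : ∏ b ∈ insert a S', w b (φ b) = w a (φ a) * ∏ b ∈ S', w b (Function.update φ a a b) := by
      rw [Finset.prod_insert ha]
      congr 1
      exact Finset.prod_congr rfl fun b hb => by rw [Function.update_of_ne (ne_of_mem_of_not_mem hb ha)]
    have himg : (insert a S').image φ = insert (φ a) (S'.image (Function.update φ a a)) := by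
      rw [Finset.image_insert]
      congr 1
      exact Finset.image_congr fun b hb => by
        simp only [Finset.mem_coe] at hb
        rw [Function.update_of_ne (ne_of_mem_of_not_mem hb ha)]
    rw [hprod, himg]
    ring

end PathTable

end

end Summit.ValiantsHypothesis.ValiantsHypothesis.Theorems.BarrierLever.HiddenStates
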